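import Mathlib

/-!
# Hadamard 668 census, family F12 — automorphisms of order 7·(f=9), 13·(f=17), 17, 19, 47 are impossible:
# two fixed points cannot lie on 166 common blocks (kernel arithmetic)

Framing: lottery ticket; floor = certified bounds/negative ranges.

Cell pub-namedobj (venture DiscreteObjects), target (H), hadamard gen 5 (FAMILY-F12-G5.md §7/§9).  Let `g` be an
automorphism of odd prime order `p` of a symmetric 2-(667,333,166) design with `f ≥ 2` fixed points (hence `f` fixed
blocks).  A fixed point lies on `333 = p·a + c` blocks: `a` whole block-orbits of length `p` and `c ≤ f` fixed blocks;
two distinct fixed points lie together on `166 = p·t + u` blocks: `t ≤ min(a, a')` common block-orbits and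
`u ≤ min(c, c')` common fixed blocks.  For `(p, f) ∈ {(7, 9), (13, 17), (17, 21), (19, 21), (47, 9)}` this little system has
no solution in natural numbers (`no_fixedPair667`, `omega` per case).  Combined with `PrimeOrderOrbitRows`
(`csPairs667`: by the orbit-row test, Lander's parity theorem and Feit's bound the only admissible fixed-point counts are
`f = 21` for `p = 17`, `f = 21` for `p = 19`, `f = 9` for `p = 47`, and `f ∈ {9, 23, …}` resp. `{17, 43}` for `p = 7, 13`
with `m = 94` resp. `50` orbits), this removes 17, 19 and 47 from the prime-order spectrum: an automorphism of odd
prime order `p` of a 2-(667,333,166) design (equivalently of H(668), for `p ∤ 668`, after normalisation) has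
`p ∈ {3, 5, 7, 11, 13, 23, 37, 41, 83}` (orbit-matrix row/fixed-structure level; FAMILY-F12-G5 §9).
Ours, not literature; no `sorry`.
-/

namespace Summit.Ventures.DiscreteObjects.Hadamard

/-- **No two fixed points.**  For the listed `(p, f)`: there are no `a, c, t, u ∈ ℕ` with `p a + c = 333`,
`c ≤ f`, `u ≤ c`, `p t + u = 166` — i.e. a fixed point (on `a` block-orbits and `c ≤ f` fixed blocks) cannot share
exactly 166 blocks (`t` common block-orbits, `u ≤ c` common fixed blocks) with a second fixed point.  (Neither `t ≤ a`
nor the second point's own equation is needed.) -/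
theorem no_fixedPair667 (p f : ℕ) (hmem : (p, f) ∈ [((7 : ℕ), (9 : ℕ)), (13, 17), (17, 21), (19, 21), (47, 9)])
    (a c t u : ℕ) (h1 : p * a + c = 333) (hc : c ≤ f) (huc : u ≤ c) (h2 : p * t + u = 166) : False := by
  simp only [List.mem_cons, Prod.mk.injEq, List.mem_nil_iff, or_false] at hmem
  rcases hmem with ⟨rfl, rfl⟩ | ⟨rfl, rfl⟩ | ⟨rfl, rfl⟩ | ⟨rfl, rfl⟩ | ⟨rfl, rfl⟩ <;> omega

/-- Instance `p = 47`: the only Lander/Feit/orbit-row-admissible structure is `m = 14` orbits and `f = 9` fixed points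
(`csPairs667` lists `(47, 12), (47, 10), (47, 8)`), and two of the nine fixed points cannot meet in 166 blocks. -/
example (a c t u : ℕ) (h1 : 47 * a + c = 333) (hc : c ≤ 9) (huc : u ≤ c) (h2 : 47 * t + u = 166) : False :=
  no_fixedPair667 47 9 (by decide) a c t u h1 hc huc h2

end Summit.Ventures.DiscreteObjects.Hadamard
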